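import Mathlib
import Literature.Computability.Complexity.ExtMonotoneGates
import Summits.PneNP.PneNP.Theorems.ConvexRankGatesCaptureDualSpan
import Summits.PneNP.PneNP.Theorems.ConvexRankGatesCaptureSignCert

/-!
# Crux `Capture` (stmt-PneNP-2659) — the level-1 SIGN TEST of the dual-PERM door is ONE PERM gate (lead c10)

Support theorem for the crux `Summit.PneNP.PneNP.Theses.ConvexRankGates.Capture`, on the crux's named load-bearing
prediction `DualPerm ∈ poly-extGate` (c7 duality audit). The "hidden sign character" of alternating sections,
which orbit/block tests cannot see, becomes visible to the PERM door itself: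

* `not_mem_span_iff_exists_dotProduct` — Hahn–Banach in coordinates; `signTest_iff_exists_dotProduct`,
  `signTest_iff_mkQ_not_mem` — `SignTest v ↔ [sgnRow τ] ∉ span {[wrow w] : wire of w OFF}` in the quotient by the
  constant rows: the shape of the dual span program.
* `signTest_circuit` (registered anchor) — **the sign test is computed by a size-ONE circuit whose gate is a PERM
  gate on `≤ 2 (n (d+1) + 1)` points** (reading each wire `d+1` times; Gál duality via c7's
  `dualSpan_onePermGate`), `signTest_circuit_extGate` — hence a size-one `B_{2(n(d+1)+1)}`-circuit.

Reading (memo `Cruxes/Capture/SIGNCERT-c10.md`): certificates of NON-membership of the form "an invariant structure of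
the unselected group on which it acts EVENLY and `τ` ODDLY" are affine `𝔽₂`-systems indexed by the unselected wires,
i.e. single dual-span PERM gates; combined with c7's orbit tests this covers `A_m`/`S_m`-sections at level 1 — the
template "sign tests at level `k` = one PERM gate on `d^k`-tuples" is immediate. Whether orbit + sign tests at
bounded level are COMPLETE for `DualPerm` is the residual question. No new definitions. [folklore]
-/

namespace Summit.PneNP.PneNP.Theorems.Capture.SignCert

set_option linter.dupNamespace false -- `Summit.PneNP.PneNP.…`: summit = sub-problem (D-0017)

open Equiv Equiv.Perm Finset

variable {d : ℕ}


open Literature.Computability.Complexity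
open Summit.PneNP.PneNP.Theorems.Capture.DualityAudit (dualSpan_onePermGate)

/-- Dot product with `e_a + e_b`. [folklore] -/
theorem pair_dotProduct (a b : Fin d) (x : Fin d → ZMod 2) :
    (Pi.single a (1 : ZMod 2) + Pi.single b 1) ⬝ᵥ x = x a + x b := by
  rw [add_dotProduct, single_dotProduct, single_dotProduct, one_mul, one_mul]

/-- **Hahn–Banach in coordinates**: a vector lies outside the span of a set of rows iff some column vector has
dot product `1` with it and `0` with every row. [folklore] -/
theorem not_mem_span_iff_exists_dotProduct (S : Set (Fin d → ZMod 2)) (t : Fin d → ZMod 2) :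
    t ∉ Submodule.span (ZMod 2) S ↔ ∃ y : Fin d → ZMod 2, t ⬝ᵥ y = 1 ∧ ∀ r ∈ S, r ⬝ᵥ y = 0 := by
  classical
  constructor
  · intro ht
    obtain ⟨f, hft, hf⟩ := Submodule.exists_dual_map_eq_bot_of_notMem ht inferInstance
    let y : Fin d → ZMod 2 := fun p => (f t)⁻¹ * f (Pi.single p 1)
    have hy : ∀ r : Fin d → ZMod 2, r ⬝ᵥ y = (f t)⁻¹ * f r := by
      intro r
      rw [LinearMap.pi_apply_eq_sum_univ f r, Finset.mul_sum, dotProduct]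
      refine Finset.sum_congr rfl fun p _ => ?_
      have hs : (fun j => if p = j then (1 : ZMod 2) else 0) = Pi.single p 1 := by
        ext j
        simp [Pi.single_apply, eq_comm]
      rw [hs, smul_eq_mul]
      ring
    refine ⟨y, ?_, fun r hr => ?_⟩
    · rw [hy, inv_mul_cancel₀ hft]
    · have hmem : f r ∈ Submodule.map f (Submodule.span (ZMod 2) S) :=
        Submodule.mem_map_of_mem (Submodule.subset_span hr)
      rw [hf, Submodule.mem_bot] at hmem
      rw [hy, hmem, mul_zero]
  · rintro ⟨y, hty, hy⟩ ht
    have hzero : ∀ r ∈ Submodule.span (ZMod 2) S, r ⬝ᵥ y = 0 := by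
      intro r hr
      refine Submodule.span_induction (p := fun r _ => r ⬝ᵥ y = 0) (fun r hr => hy r hr) ?_ ?_ ?_ hr
      · exact zero_dotProduct _
      · intro a b _ _ ha hb
        rw [add_dotProduct, ha, hb, add_zero]
      · intro c a _ ha
        rw [smul_dotProduct, ha, smul_zero]
    have h0 := hzero t ht
    rw [hty] at h0
    exact one_ne_zero h0

/-- Quotient form: kill a fixed set of rows. [folklore] -/
theorem not_mem_span_union_iff_mkQ {E : Type*} [AddCommGroup E] [Module (ZMod 2) E] (R G : Set E) (t : E) :
    t ∉ Submodule.span (ZMod 2) (R ∪ G) ↔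
      (Submodule.span (ZMod 2) R).mkQ t ∉
        Submodule.span (ZMod 2) ((Submodule.span (ZMod 2) R).mkQ '' G) := by
  rw [Submodule.span_union, ← Submodule.map_span, ← Submodule.mem_comap, Submodule.comap_map_mkQ]

variable {n : ℕ}

/-- The sign test as an `𝔽₂`-linear feasibility problem: constant rows and the rows of the OFF wires homogeneous,
the target row inhomogeneous. [folklore] -/
theorem signTest_iff_exists_dotProduct (σ : Fin n → Perm (Fin d)) (τ : Perm (Fin d)) (v : Fin n → Bool) :
    SignTest σ τ v ↔ ∃ y : Fin d → ZMod 2, sgnRow τ ⬝ᵥ y = 1 ∧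
      ∀ r ∈ crow τ ∪ wrow σ '' {w | v w.1 = false}, r ⬝ᵥ y = 0 := by
  have add_eq_zero_iff_eq_zmod2 : ∀ a b : ZMod 2, a + b = 0 ↔ a = b := by decide
  constructor
  · rintro ⟨x, hτ, hsτ, hσ⟩
    refine ⟨x, hsτ, ?_⟩
    rintro r (⟨p, rfl⟩ | ⟨⟨i, k⟩, hi, rfl⟩)
    · rw [pair_dotProduct, add_eq_zero_iff_eq_zmod2, hτ]
    · simp only [Set.mem_setOf_eq] at hi
      obtain ⟨hxi, hsi⟩ := hσ i hi
      rcases k with p | u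
      · show (Pi.single (σ i p) (1 : ZMod 2) + Pi.single p 1) ⬝ᵥ x = 0
        rw [pair_dotProduct, add_eq_zero_iff_eq_zmod2, hxi]
      · exact hsi
  · rintro ⟨y, hty, hy⟩
    refine ⟨y, fun p => ?_, hty, fun i hi => ⟨fun p => ?_, ?_⟩⟩
    · have h := hy _ (Or.inl ⟨p, rfl⟩)
      rwa [pair_dotProduct, add_eq_zero_iff_eq_zmod2] at h
    · have h := hy _ (Or.inr ⟨(i, Sum.inl p), hi, rfl⟩)
      change (Pi.single (σ i p) (1 : ZMod 2) + Pi.single p 1) ⬝ᵥ y = 0 at h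
      rwa [pair_dotProduct, add_eq_zero_iff_eq_zmod2] at h
    · exact hy _ (Or.inr ⟨(i, Sum.inr ()), hi, rfl⟩)

/-- **The sign test in dual-span form**: `SignTest v ↔ [t] ∉ span {[wrow w] : wire of w is OFF}` in the
quotient by the constant rows — the shape of `dualSpan_onePermGate`. [folklore] -/
theorem signTest_iff_mkQ_not_mem (σ : Fin n → Perm (Fin d)) (τ : Perm (Fin d)) (v : Fin n → Bool) :
    SignTest σ τ v ↔ (Submodule.span (ZMod 2) (crow τ)).mkQ (sgnRow τ) ∉
      Submodule.span (ZMod 2) ((Submodule.span (ZMod 2) (crow τ)).mkQ '' (wrow σ '' {w | v w.1 = false})) := by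
  rw [← not_mem_span_union_iff_mkQ, not_mem_span_iff_exists_dotProduct, signTest_iff_exists_dotProduct]

open Classical in
/-- **The sign test is ONE PERM gate** (a size-one circuit whose gate is a PERM gate on `≤ 2 (n (d+1) + 1)`
points, reading each wire `d + 1` times): the level-1 sign certificates of the dual-PERM door are captured
by the PERM door itself. [folklore] -/
theorem signTest_circuit : ∀ (d n : ℕ) (σ : Fin n → Perm (Fin d)) (τ : Perm (Fin d)),
    ∃ C : Circuit (Fin n), C.IsOver {g | IsPermGate (2 * (n * (d + 1) + 1)) g} ∧ C.size ≤ 1 ∧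
      C.Computes (fun v => decide (SignTest σ τ v)) := by
  intro d n σ τ
  classical
  let X := Fin d → ZMod 2
  let U : Submodule (ZMod 2) X := Submodule.span (ZMod 2) (crow τ)
  let Q := X ⧸ U
  let W := Fin n × (Fin d ⊕ Unit)
  let eW : W ≃ Fin (Fintype.card W) := Fintype.equivFin W
  have hcard : Fintype.card W = n * (d + 1) := by
    simp [W, Fintype.card_prod, Fintype.card_sum]
  let a : Fin (Fintype.card W) → Q := fun j => U.mkQ (wrow σ (eW.symm j))
  let tQ : Q := U.mkQ (sgnRow τ)
  let g : (Fin (Fintype.card W) → Bool) → Bool := fun u =>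
    decide (tQ ∉ Submodule.span (ZMod 2) (a '' {j | u j = false}))
  have hg : IsPermGate (2 * (n * (d + 1) + 1)) ⟨Fintype.card W, g⟩ :=
    (dualSpan_onePermGate Q (Fintype.card W) a tQ g (fun u => by simp only [g, decide_eq_true_eq])).mono
      (by rw [hcard])
  obtain ⟨C, hB, hs, hev⟩ := (CktSize.gate (B := {g' | IsPermGate (2 * (n * (d + 1) + 1)) g'})
    ⟨Fintype.card W, g⟩ hg (fun j => (eW.symm j).1)).toCircuit
  refine ⟨C, hB, hs, fun x => ?_⟩
  rw [hev x]
  change decide (tQ ∉ Submodule.span (ZMod 2) (a '' {j | x (eW.symm j).1 = false})) = decide (SignTest σ τ x)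
  apply Bool.decide_congr
  have himg : a '' {j : Fin (Fintype.card W) | x (eW.symm j).1 = false} =
      U.mkQ '' (wrow σ '' {w : W | x w.1 = false}) := by
    ext q
    simp only [Set.mem_image, Set.mem_setOf_eq, a]
    constructor
    · rintro ⟨j, hj, rfl⟩
      exact ⟨wrow σ (eW.symm j), ⟨eW.symm j, hj, rfl⟩, rfl⟩
    · rintro ⟨_, ⟨w, hw, rfl⟩, rfl⟩
      refine ⟨eW w, ?_, by simp⟩
      show x (eW.symm (eW w)).1 = false
      rw [Equiv.symm_apply_apply]
      exact hw
  rw [himg, signTest_iff_mkQ_not_mem]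

open Classical in
/-- In particular the sign test is a size-one circuit over the extended basis `B_{2(n(d+1)+1)}`. [folklore] -/
theorem signTest_circuit_extGate (d n : ℕ) (σ : Fin n → Perm (Fin d)) (τ : Perm (Fin d)) :
    ∃ C : Circuit (Fin n), C.IsOver (extGate (2 * (n * (d + 1) + 1))) ∧ C.size ≤ 1 ∧
      C.Computes (fun v => decide (SignTest σ τ v)) := by
  obtain ⟨C, hB, hs, hC⟩ := signTest_circuit d n σ τ
  exact ⟨C, hB.mono fun g hg => IsPermGate.mem_extGate hg, hs, hC⟩


end Summit.PneNP.PneNP.Theorems.Capture.SignCert
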